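import Literature.NumberTheory.EllipticCurves.ZpExtensionEisensteinDVRSettingSatisfiesHOfLiftsProofs
import Literature.NumberTheory.EllipticCurves.ZpExtensionEisensteinDVRSettingDualityDataProofs
import Literature.NumberTheory.EllipticCurves.ZpExtensionEisensteinConjugationDatumProofs
import Summits.BirchSwinnertonDyer.BirchSwinnertonDyer.Theorems.UniversalToricDescentTwinSchurAtThree
import Summits.BirchSwinnertonDyer.BirchSwinnertonDyer.Theorems.SchneiderFreeAdditiveX3PoitouTateSelmerDualityHolds
import HarnessLib

/-!
# Howard's `SatisfiesH` for the Eisenstein setting of a curve with SURJECTIVE `ρ̄_{E,p}` (`p` odd) over an imaginary quadratic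
# `K`, modulo the local clauses at `v ∈ S` — the E2 («H-twin») unit of the twin's K2 stub, JOINED to cell x9's engine

Helper file (THEOREMS ONLY: no definition, no named fact, no instance, no `sorry`) for crux r205 stmt-BirchSwinnertonDyer-24737
`…Theses.UniversalToricDescent.TwinAlgMuZeroAtThree`, line `beta-road` (skeleton v10 cd44fe9d5c6b9a78), stub
`stub_howardOutputsOfFamily` (K2_Howard ∣ β).  The twin analogue of x9/x10b's
`…Theorems.HeegnerMuPartHowardSettingERed.exists_eisensteinSettingData_satisfiesH_eRed_of_thm413Hypotheses` (p659673 + sequel):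
there, the frames were CGLS 2022 Thm. 4.1.3 (`p ∤ 2 d_K` good ORDINARY, inertia device for H.1/H.2); here the ONLY global inputs are
`W.HasSurjectiveModNGaloisRep p` (`p` odd), `IsImaginaryQuadratic K` and `κ.IsAnticyclotomic` — the hypotheses the crux carries for
the twin `E′` at `p = 3` (multiplicative très ramifié OR good supersingular; no reduction type is used here).  H.1 (irreducibility +
Schur over `K`) and the homothety of H.2 come from `…Theorems.UniversalToricDescentTwinSchurAtThree` (p752645, squares trick); the
canonical conjugation datum, the Weil–`τ` duality data `D` with `e_red`/H.5(c), H.3, and the off-`S` halves of H.4/H.5(b) are cell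
x9's D1 theorems BY NAME (`exists_conjugationDatum_ofLifts_τ_eq_absGaloisTransport`, `exists_eisensteinDualityData`,
`eisensteinDVRSettingLevelsTame_satisfiesH_of_ofLifts`).

* **`exists_eisensteinSettingData_satisfiesH_eRed_of_hasSurjectiveModNGaloisRep`** — for the Eisenstein tower of `E_K` at an
  anticyclotomic `κ`, any `m ≥ 1`, tame pins `π`, an `Aut(K/ℚ)`-stable finite `S ⊇ {v ∣ p} ∪ {bad}`, admissible `𝓛` off `S`, `jbar`:
  there are `c₀` (complex conjugation), `σ` (the involution of `K`) lifted by `e c₀ e⁻¹`, H.4 data `D` from a Weil family `e` and a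
  logarithm `log` with all exported identities (items (1)–(9) of `exists_eisensteinDualityData`), such that
  `(W.eisensteinDVRSettingLevelsTame κ hm π S … cd D).SatisfiesH` holds AS SOON AS the H.4 / H.5(b) clauses at the places `v ∈ S`
  hold for this `D` (`hfin4`, `hfin5b`) — given the Poitou–Tate named fact `poitouTate_selmerStructure_duality K` (binder `hPT`).
What it does NOT supply (the E2 residue of the K2 stub, numbers not adjectives): the clauses at `v ∈ S` — at `v ∣ p` the isotropy /
(Exact) inputs of x9's `eisensteinTower_isSelfOrthogonalAt_of_mem` for `ordinaryFiltrationAt v` (for the twin at multiplicative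
`v ∣ 3`: the TATE LINE `μ_{3^k} ⊂ E′[3^k]`), at bad `v ∤ p` the uniform local torsion (N1) of
`eisensteinTower_isSelfOrthogonalAt_of_mem_of_not_mem_ofLifts`; H.5(b) at `v ∈ S` —, `LargePrimes` (x9 `eisensteinDVRSetting_largePrimes`),
the Kolyvagin system of the twin at `3 ∥ N′` (KS-twin), the controls (D1-twin) and Howard's Thm. 1.6.1 (F-161′).  HONEST FRAMING:
conditional on `poitouTate_selmerStructure_duality K` as a hypothesis.  For the crux apply at `p = 3` with
`W′.HasSurjectiveModNGaloisRep 3` rewritten along `Nat.cast_ofNat`.  BSD is NOT proved by this file; 24737 stays OPEN.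

References: B. Howard, Compositio Math. 140 (2004), §1.3 H.0–H.5, §1.6 (arXiv:1202.6340 p. 7–8, p. 11) [Howard2004HeegnerKolyvagin];
J. S. Milne, *Arithmetic Duality Theorems* (2006), I Thm. 2.6, 4.10 [MilneADT2006]; J.-P. Serre, Invent. Math. 15 (1972) §2 [Serre1972].
-/

set_option autoImplicit false
-- the summit and its single problem are both named `BirchSwinnertonDyer` (registry layout D-0017)
set_option linter.dupNamespace false

noncomputable section

open Function NumberField IsDedekindDomain Field
open scoped NumberField ContRepresentation TensorProduct Classical
open Literature.NumberTheory.EllipticCurves Literature.NumberTheory.GaloisRepresentations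
open Literature.NumberTheory.GaloisRepresentations.DiscreteGaloisModule
open Literature.NumberTheory.GaloisCohomology Literature.NumberTheory.GaloisCohomology.Howard2004
open Literature.NumberTheory.EllipticCurves.ZpExtension (EisensteinLevel)
open WeierstrassCurve (geomTorsion)
open Summit.BirchSwinnertonDyer.BirchSwinnertonDyer.Theorems.UniversalToricDescentTwinSchurAtThree

namespace Summit.BirchSwinnertonDyer.BirchSwinnertonDyer.Theorems.UniversalToricDescentTwinHowardSettingSatisfiesH

variable {W : WeierstrassCurve ℚ} [W.IsElliptic] {K : Type} [Field K] [NumberField K]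
  {p : ℕ} [hp : Fact p.Prime] {κ : ZpExtension K p}

/-- `p ∤ (−1) − 1` for an odd prime `p` (the `ha` clause of the homothety `−1`). [folklore] -/
theorem not_dvd_neg_one_sub_one (hp2 : p ≠ 2) : ¬ (p : ℤ) ∣ (-1 : ℤ) - 1 := by
  intro h
  have h2 : (p : ℤ) ∣ ((2 : ℕ) : ℤ) := by
    rw [show ((-1 : ℤ) - 1) = -((2 : ℕ) : ℤ) by norm_num, Int.dvd_neg] at h
    exact h
  exact hp2 ((Nat.prime_dvd_prime_iff_eq hp.out Nat.prime_two).mp (Int.natCast_dvd_natCast.mp h2))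

set_option synthInstance.maxHeartbeats 80000 in
set_option maxHeartbeats 800000 in
/-- **The setting-data half of the twin's E2 unit («H-twin»), from surjectivity alone.**  For `E/ℚ` with `ρ̄_{E,p}` onto (`p` odd),
`K` imaginary quadratic, `κ` anticyclotomic and the Poitou–Tate named fact: for the Eisenstein tower at `κ`, `m ≥ 1`, pins `π`, an
`Aut(K/ℚ)`-stable `S ⊇ {v ∣ p} ∪ {bad}`, `𝓛` admissible off `S`, `jbar`, there are `c₀` (complex conjugation in `Γ_ℚ`), `σ ≠ 1`,
`σ² = 1` lifted by the involution `e c₀ e⁻¹`, H.4 data `D` from a Weil family `e` and a logarithm `log` — with `cd.τ = e c₀ e⁻¹`,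
`(D k).e = eisensteinDualityForm … (conjPairing (e (k+1)) τ_* (log (k+1)))`, `e_red`, `e` alternating / `Γ_K`-equivariant /
`τ`-anti-invariant, `τ_*` involutive, `log` bijective and `χ̄`-equivariant — such that `SatisfiesH` of the levels-tame setting with the
canonical conjugation datum holds once the H.4 / H.5(b) clauses at the places `v ∈ S` hold for this `D`.  H.1 and the homothety
`−1` of H.2 are `twin`-file theorems from `ρ̄` onto (p752645); everything else is x9's D1 road by name.
[cite: Howard2004HeegnerKolyvagin, §1.3 H.0–H.5 and §1.6 (arXiv p. 7 L33 – p. 8 L1, p. 11 L13–38)]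
[cite: MilneADT2006, Ch. I, Thm. 2.6 and Thm. 4.10(b)] [cite: Serre1972, §2 (subgroups of GL₂(𝔽_p))] -/
theorem exists_eisensteinSettingData_satisfiesH_eRed_of_hasSurjectiveModNGaloisRep
    (hp2 : p ≠ 2) (hsurj : W.HasSurjectiveModNGaloisRep (p : ℤ)) (hK : IsImaginaryQuadratic K)
    (hanti : κ.IsAnticyclotomic)
    (hPT : poitouTate_selmerStructure_duality K)
    {m : ℕ} (hm : 1 ≤ m) (π : ∀ v : HeightOneSpectrum (𝓞 K), TamePin v)
    (S : Finset (HeightOneSpectrum (𝓞 K)))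
    (hpS : ∀ v : HeightOneSpectrum (𝓞 K), ((p : ℕ) : 𝓞 K) ∈ v.asIdeal → v ∈ S)
    (hbad : ∀ v : HeightOneSpectrum (𝓞 K), v ∉ S → ((p : ℕ) : 𝓞 K) ∉ v.asIdeal → (W.baseChange K).HasGoodReductionAt v)
    (hSσ : ∀ (σ : K ≃ₐ[ℚ] K) (v : HeightOneSpectrum (𝓞 K)), σ • v ∈ S → v ∈ S)
    (L : Set (HeightOneSpectrum (𝓞 K)))
    (hL : letI := IwasawaAlgebra.isLocalRing_quotient_X_pow_add_C p hm
      L ⊆ (W.eisensteinTower κ hm).degreeTwoPrimes p)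
    (hLS : ∀ v ∈ L, v ∉ S) (jbar : AlgebraicClosure K →+* ℂ) :
    letI := IwasawaAlgebra.isDomain_quotient_X_pow_add_C p hm
    letI := IwasawaAlgebra.isDiscreteValuationRing_quotient_X_pow_add_C p hm
    haveI := IwasawaAlgebra.EisensteinCoeff.isLocalRing_succ p hm
    letI := IwasawaAlgebra.EisensteinCoeff.algebraOfSpecSucc p m
    haveI := W.isScalarTower_algebraOfSpecSucc (K := K) (p := p) (m := m)
    letI := W.residueModuleSucc (K := K) (p := p) hm
    ∃ (c₀ : absoluteGaloisGroup ℚ) (σ : K ≃ₐ[ℚ] K) (hσ₁ : σ ≠ 1) (hσ : σ * σ = 1)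
      (hτl : IsLiftOfAut σ (absGaloisTransport (K := ℚ) (L := K) c₀).toRingEquiv)
      (hτ₂ : Function.Involutive (absGaloisTransport (K := ℚ) (L := K) c₀).toRingEquiv)
      (D : ∀ k, DualityDatum p (ConjugationDatum.ofLifts σ hσ₁ hσ _ hτl hτ₂) ((W.eisensteinTower κ hm).ρ k)
        (IwasawaAlgebra.EisensteinCoeff p m (k + 1)))
      (e : ∀ j : ℕ, geomTorsion (W.baseChange K) ((p : ℤ) ^ j) →+ geomTorsion (W.baseChange K) ((p : ℤ) ^ j) →+
        MuCarrier K (p ^ j))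
      (log : ∀ j : ℕ, MuCarrier K (p ^ j) →+ ZMod (p ^ j)),
      IsComplexConjugation (Rat.castHom ℝ) c₀ ∧
      (∀ x, (ConjugationDatum.ofLifts σ hσ₁ hσ _ hτl hτ₂).τ x = absGaloisTransport (K := ℚ) (L := K) c₀ x) ∧
      (∀ k, (D k).e = ZpExtension.eisensteinDualityForm hm (k + 1)
        (conjPairing (e (k + 1)) ((ConjugationDatum.ofLifts σ hσ₁ hσ _ hτl hτ₂).isLift.torsionMap W _) (log (k + 1)))) ∧
      (∀ k (x y : EisensteinLevel p m (fun j ↦ geomTorsion (W.baseChange K) ((p : ℤ) ^ j)) (k + 1 + 1)),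
        IwasawaAlgebra.EisensteinCoeff.reduce p m (Nat.le_succ (k + 1)) ((D (k + 1)).e x y) =
          (D k).e ((W.eisensteinTower κ hm).red k x) ((W.eisensteinTower κ hm).red k y)) ∧
      (∀ j a, e j a a = 0) ∧
      (∀ j (g : absoluteGaloisGroup K) a b, e j (g • a) (g • b) = mu K (p ^ j) g (e j a b)) ∧
      (∀ j a b, e j ((ConjugationDatum.ofLifts σ hσ₁ hσ _ hτl hτ₂).isLift.torsionMap W _ a)
        ((ConjugationDatum.ofLifts σ hσ₁ hσ _ hτl hτ₂).isLift.torsionMap W _ b) = -e j a b) ∧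
      (∀ j (a : geomTorsion (W.baseChange K) ((p : ℤ) ^ j)),
        (ConjugationDatum.ofLifts σ hσ₁ hσ _ hτl hτ₂).isLift.torsionMap W _
          ((ConjugationDatum.ofLifts σ hσ₁ hσ _ hτl hτ₂).isLift.torsionMap W _ a) = a) ∧
      (∀ j, Function.Bijective (log j)) ∧
      (∀ j (g : absoluteGaloisGroup K) ξ, log j (mu K (p ^ j) g ξ) = cyclotomicCharacterModPow K p j g * log j ξ) ∧
      ((letI := IwasawaAlgebra.isLocalRing_quotient_X_pow_add_C p hm
        ∀ k, ∀ v ∈ S, (D k).IsSelfOrthogonalAt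
          (W.eisensteinTowerTriple κ hm S hpS hbad L hL hLS k).cond v) →
       (∀ k, ∀ v ∈ S,
        (((W.isQuotientBy_eisensteinDVRSetting_πbar κ hm S hpS hbad L hL hLS jbar
            (ConjugationDatum.ofLifts σ hσ₁ hσ _ hτl hτ₂) D
            (W.eisensteinLevelsTameFs κ hm π S hpS hbad L hL hLS)
            k).propagateStructure (W.eisensteinTowerTriple κ hm S hpS hbad L hL hLS k).cond)
            (Sum.inr (σ • v))).map
            (((W.residualTauGeomTorsion (p := p) (ConjugationDatum.ofLifts σ hσ₁ hσ _ hτl hτ₂) hm (k := k + 1)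
                k.succ_pos).thetaH1 (Sum.inr v)).comp
              ((ConjugationDatum.ofLifts σ hσ₁ hσ _ hτl hτ₂).transportH1
                ((W.baseChange K).torsionGaloisModule (p : ℤ)) v)) =
          ((W.isQuotientBy_eisensteinDVRSetting_πbar κ hm S hpS hbad L hL hLS jbar
            (ConjugationDatum.ofLifts σ hσ₁ hσ _ hτl hτ₂) D
            (W.eisensteinLevelsTameFs κ hm π S hpS hbad L hL hLS)
            k).propagateStructure (W.eisensteinTowerTriple κ hm S hpS hbad L hL hLS k).cond)
            (Sum.inr v)) →
       (W.eisensteinDVRSettingLevelsTame κ hm π S hpS hbad L hL hLS jbar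
          (ConjugationDatum.ofLifts σ hσ₁ hσ _ hτl hτ₂) D).SatisfiesH) := by
  letI := IwasawaAlgebra.isDomain_quotient_X_pow_add_C p hm
  letI := IwasawaAlgebra.isDiscreteValuationRing_quotient_X_pow_add_C p hm
  haveI := IwasawaAlgebra.EisensteinCoeff.isLocalRing_succ p hm
  letI := IwasawaAlgebra.EisensteinCoeff.algebraOfSpecSucc p m
  haveI := W.isScalarTower_algebraOfSpecSucc (K := K) (p := p) (m := m)
  letI := W.residueModuleSucc (K := K) (p := p) hm
  haveI : IsTotallyComplex K := hK.isTotallyComplex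
  have himag : ∀ w : NumberField.InfinitePlace K, w.IsComplex := fun w ↦ IsTotallyComplex.isComplex w
  -- §1 frame: a complex conjugation of `ℚ̄`; H.1 and the homothety `−1` of H.2 from `ρ̄` onto (squares trick, p752645)
  obtain ⟨c₀, hc₀⟩ := exists_isComplexConjugation (Rat.castHom ℝ)
  obtain ⟨z, hz⟩ := exists_smul_eq_neg_baseChange_of_hasSurjectiveModNGaloisRep W K hK.1 hsurj
  have ha : ¬ (p : ℤ) ∣ (-1 : ℤ) - 1 := not_dvd_neg_one_sub_one hp2
  have hirrK : (W.baseChange K).HasIrreducibleModPGaloisRep p :=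
    hasIrreducibleModPGaloisRep_baseChange_of_hasSurjectiveModNGaloisRep W K hK.1 hp2 hsurj
  -- §2 the canonical conjugation datum
  obtain ⟨σ, hσ₁, hσ, hτl, hτ₂, -, hτ⟩ := exists_conjugationDatum_ofLifts_τ_eq_absGaloisTransport hK hc₀
  -- §3 the instantiated H.4 data (Weil–`τ` forms), with `e_red` and H.5(c)
  obtain ⟨D, e, log, hDe, he_red, h5c, h4', h5', h6', h7', h8', h9'⟩ :=
    W.exists_eisensteinDualityData κ hm S hpS hbad L hL hLS jbar
      (ConjugationDatum.ofLifts σ hσ₁ hσ _ hτl hτ₂) hanti himag hc₀ hτ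
  refine ⟨c₀, σ, hσ₁, hσ, hτl, hτ₂, D, e, log, hc₀, hτ, hDe, he_red, h4', h5', h6', h7', h8', h9', fun hfin4 hfin5b ↦ ?_⟩
  -- §4 `SatisfiesH` (x9's assembly, the four frame inputs by name)
  exact W.eisensteinDVRSettingLevelsTame_satisfiesH_of_ofLifts κ hm π S hpS hbad L hL hLS jbar σ hσ₁ hσ _
    hτl hτ₂ D hp2 hK hirrK
    (fun φ hφ ↦ exists_forall_eq_zsmul_baseChange_of_hasSurjectiveModNGaloisRep W K hK.1 hp2 hsurj φ hφ)
    κ rfl hanti hz ha hc₀ hτ hPT (hSσ σ) he_red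
    (h5c (W.eisensteinLevelsTameFs κ hm π S hpS hbad L hL hLS)) hfin4 hfin5b

set_option synthInstance.maxHeartbeats 80000 in
set_option maxHeartbeats 800000 in
/-- **The same, UNCONDITIONALLY**: the Poitou–Tate binder `hPT : poitouTate_selmerStructure_duality K` of
`exists_eisensteinSettingData_satisfiesH_eRed_of_hasSurjectiveModNGaloisRep` is a tree theorem
(`SchneiderFreeAdditiveX3.PoitouTateReduction.poitouTate_selmerStructure_duality_holds`, Milne ADT I Thm. 4.10(b) for the canonical local
invariants), so the setting-data half of the twin's E2 unit holds from `ρ̄_{E,p}` onto, `K` imaginary quadratic and `κ` anticyclotomic alone,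
modulo the local clauses at `v ∈ S`. [cite: Howard2004HeegnerKolyvagin, §1.3 H.0–H.5 and §1.6 (arXiv p. 7 L33 – p. 8 L1)]
[cite: MilneADT2006, Ch. I, Thm. 2.6 and Thm. 4.10(b)] -/
theorem exists_eisensteinSettingData_satisfiesH_eRed_of_hasSurjectiveModNGaloisRep_unconditional
    (hp2 : p ≠ 2) (hsurj : W.HasSurjectiveModNGaloisRep (p : ℤ)) (hK : IsImaginaryQuadratic K)
    (hanti : κ.IsAnticyclotomic)
    {m : ℕ} (hm : 1 ≤ m) (π : ∀ v : HeightOneSpectrum (𝓞 K), TamePin v)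
    (S : Finset (HeightOneSpectrum (𝓞 K)))
    (hpS : ∀ v : HeightOneSpectrum (𝓞 K), ((p : ℕ) : 𝓞 K) ∈ v.asIdeal → v ∈ S)
    (hbad : ∀ v : HeightOneSpectrum (𝓞 K), v ∉ S → ((p : ℕ) : 𝓞 K) ∉ v.asIdeal → (W.baseChange K).HasGoodReductionAt v)
    (hSσ : ∀ (σ : K ≃ₐ[ℚ] K) (v : HeightOneSpectrum (𝓞 K)), σ • v ∈ S → v ∈ S)
    (L : Set (HeightOneSpectrum (𝓞 K)))
    (hL : letI := IwasawaAlgebra.isLocalRing_quotient_X_pow_add_C p hm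
      L ⊆ (W.eisensteinTower κ hm).degreeTwoPrimes p)
    (hLS : ∀ v ∈ L, v ∉ S) (jbar : AlgebraicClosure K →+* ℂ) :
    letI := IwasawaAlgebra.isDomain_quotient_X_pow_add_C p hm
    letI := IwasawaAlgebra.isDiscreteValuationRing_quotient_X_pow_add_C p hm
    haveI := IwasawaAlgebra.EisensteinCoeff.isLocalRing_succ p hm
    letI := IwasawaAlgebra.EisensteinCoeff.algebraOfSpecSucc p m
    haveI := W.isScalarTower_algebraOfSpecSucc (K := K) (p := p) (m := m)
    letI := W.residueModuleSucc (K := K) (p := p) hm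
    ∃ (c₀ : absoluteGaloisGroup ℚ) (σ : K ≃ₐ[ℚ] K) (hσ₁ : σ ≠ 1) (hσ : σ * σ = 1)
      (hτl : IsLiftOfAut σ (absGaloisTransport (K := ℚ) (L := K) c₀).toRingEquiv)
      (hτ₂ : Function.Involutive (absGaloisTransport (K := ℚ) (L := K) c₀).toRingEquiv)
      (D : ∀ k, DualityDatum p (ConjugationDatum.ofLifts σ hσ₁ hσ _ hτl hτ₂) ((W.eisensteinTower κ hm).ρ k)
        (IwasawaAlgebra.EisensteinCoeff p m (k + 1)))
      (e : ∀ j : ℕ, geomTorsion (W.baseChange K) ((p : ℤ) ^ j) →+ geomTorsion (W.baseChange K) ((p : ℤ) ^ j) →+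
        MuCarrier K (p ^ j))
      (log : ∀ j : ℕ, MuCarrier K (p ^ j) →+ ZMod (p ^ j)),
      IsComplexConjugation (Rat.castHom ℝ) c₀ ∧
      (∀ x, (ConjugationDatum.ofLifts σ hσ₁ hσ _ hτl hτ₂).τ x = absGaloisTransport (K := ℚ) (L := K) c₀ x) ∧
      (∀ k, (D k).e = ZpExtension.eisensteinDualityForm hm (k + 1)
        (conjPairing (e (k + 1)) ((ConjugationDatum.ofLifts σ hσ₁ hσ _ hτl hτ₂).isLift.torsionMap W _) (log (k + 1)))) ∧
      (∀ k (x y : EisensteinLevel p m (fun j ↦ geomTorsion (W.baseChange K) ((p : ℤ) ^ j)) (k + 1 + 1)),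
        IwasawaAlgebra.EisensteinCoeff.reduce p m (Nat.le_succ (k + 1)) ((D (k + 1)).e x y) =
          (D k).e ((W.eisensteinTower κ hm).red k x) ((W.eisensteinTower κ hm).red k y)) ∧
      (∀ j a, e j a a = 0) ∧
      (∀ j (g : absoluteGaloisGroup K) a b, e j (g • a) (g • b) = mu K (p ^ j) g (e j a b)) ∧
      (∀ j a b, e j ((ConjugationDatum.ofLifts σ hσ₁ hσ _ hτl hτ₂).isLift.torsionMap W _ a)
        ((ConjugationDatum.ofLifts σ hσ₁ hσ _ hτl hτ₂).isLift.torsionMap W _ b) = -e j a b) ∧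
      (∀ j (a : geomTorsion (W.baseChange K) ((p : ℤ) ^ j)),
        (ConjugationDatum.ofLifts σ hσ₁ hσ _ hτl hτ₂).isLift.torsionMap W _
          ((ConjugationDatum.ofLifts σ hσ₁ hσ _ hτl hτ₂).isLift.torsionMap W _ a) = a) ∧
      (∀ j, Function.Bijective (log j)) ∧
      (∀ j (g : absoluteGaloisGroup K) ξ, log j (mu K (p ^ j) g ξ) = cyclotomicCharacterModPow K p j g * log j ξ) ∧
      ((letI := IwasawaAlgebra.isLocalRing_quotient_X_pow_add_C p hm
        ∀ k, ∀ v ∈ S, (D k).IsSelfOrthogonalAt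
          (W.eisensteinTowerTriple κ hm S hpS hbad L hL hLS k).cond v) →
       (∀ k, ∀ v ∈ S,
        (((W.isQuotientBy_eisensteinDVRSetting_πbar κ hm S hpS hbad L hL hLS jbar
            (ConjugationDatum.ofLifts σ hσ₁ hσ _ hτl hτ₂) D
            (W.eisensteinLevelsTameFs κ hm π S hpS hbad L hL hLS)
            k).propagateStructure (W.eisensteinTowerTriple κ hm S hpS hbad L hL hLS k).cond)
            (Sum.inr (σ • v))).map
            (((W.residualTauGeomTorsion (p := p) (ConjugationDatum.ofLifts σ hσ₁ hσ _ hτl hτ₂) hm (k := k + 1)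
                k.succ_pos).thetaH1 (Sum.inr v)).comp
              ((ConjugationDatum.ofLifts σ hσ₁ hσ _ hτl hτ₂).transportH1
                ((W.baseChange K).torsionGaloisModule (p : ℤ)) v)) =
          ((W.isQuotientBy_eisensteinDVRSetting_πbar κ hm S hpS hbad L hL hLS jbar
            (ConjugationDatum.ofLifts σ hσ₁ hσ _ hτl hτ₂) D
            (W.eisensteinLevelsTameFs κ hm π S hpS hbad L hL hLS)
            k).propagateStructure (W.eisensteinTowerTriple κ hm S hpS hbad L hL hLS k).cond)
            (Sum.inr v)) →
       (W.eisensteinDVRSettingLevelsTame κ hm π S hpS hbad L hL hLS jbar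
          (ConjugationDatum.ofLifts σ hσ₁ hσ _ hτl hτ₂) D).SatisfiesH) :=
  exists_eisensteinSettingData_satisfiesH_eRed_of_hasSurjectiveModNGaloisRep (W := W) (K := K) (κ := κ) hp2 hsurj hK hanti
    (SchneiderFreeAdditiveX3.PoitouTateReduction.poitouTate_selmerStructure_duality_holds K) hm π S hpS hbad hSσ L hL hLS jbar

end Summit.BirchSwinnertonDyer.BirchSwinnertonDyer.Theorems.UniversalToricDescentTwinHowardSettingSatisfiesH

end
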